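import Literature.AlgebraicGeometry.AbelianSchemes.DualIsogenyMulN
import Literature.AlgebraicGeometry.AbelianSchemes.AbelianSchemeQuotientPolarizationIdentity
import Literature.AlgebraicGeometry.AbelianSchemes.SerreTensorIdealTranslationQuasiInverse
import HarnessLib

/-!
# The dual of a quasi-inverse pair is a quasi-inverse pair: `ψ′ ≫ ψ = [N] ⟹ ψ^∨ ≫ ψ′^∨ = [N]`; the case of the ideal translation `ψ_P`

Topic `Literature/AlgebraicGeometry/AbelianSchemes`, namespace `Literature.AlgebraicGeometry.AbelianSchemes.AbelianSchemeOver` (THEOREMS ONLY; no definition, no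
named fact, no `sorry`, no `instance`, no notation; base `S` reduced and locally Noetherian — the standing hypotheses of ★ `dualIsogenyOver_mulN`).  Cell
`hodgecm-mathlib`, F0/P6 «MOD», the `hχ` FEED of ★ (λ) `AbelianSchemeHomDescentPolarized` (p845427: polarised recognition needs `ψ^∨ ≫ χ′ = [M]`), over ★
`DualIsogenyMulN` (`[n]^∨ = [n]`), ★ `AbelianSchemeDualIsogenyComp` (`(ψ ≫ χ)^∨ = χ^∨ ≫ ψ^∨`), ★ `dualIsogenyOver_congr`, and ★ (A″) `SerreTensorIdealTranslationQuasiInverse`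
(`ψ′ ≫ ψ_P = [N]`); `--supports stmt-HodgeConjecture-24832`, count-neutral.  HC_CM is proved only modulo the 2 remaining named inputs (hLiu418, h413) until rung 0
closes; this file discharges none of them.

## Mathematics

For homomorphisms `ψ : A → C`, `ψ′ : C → A` of abelian schemes with `ψ′ ≫ ψ = [N]_C` and dual pairs `D_A`, `D_C` (unit hypothesis `hD_C`):
`ψ^∨ ≫ ψ′^∨ = (ψ′ ≫ ψ)^∨ = [N]_C^∨ = [N]_{Ĉ}` ([MumfordAV1970] §15 Thm. 1: `f ↦ f^∨` is contravariantly functorial and `[n]^∨ = [n]`).  In particular the dual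
`ψ_P^∨` of the ideal translation `ψ_P : A → A ⊗_𝒪 𝔟` (★ `serreTranslate`, quasi-inverse `ψ′` of ★ (A″)) has the quasi-inverse `ψ′^∨` — the literal `hχ` of ★
`comp_lam_comp_dualIsogenyOver_eq_of_pullback_eq` for `ψ := ψ_P`.

## Contents

* **`dualIsogenyOver_comp_dualIsogenyOver_eq_pow_id`** (`ψ′ ≫ ψ = (𝟙 C)^N ⟹ ψ^∨ ≫ ψ′^∨ = (𝟙 Ĉ)^N`);
* **`dualIsogenyOver_serreTranslate_comp_eq_pow_id`** (the case `ψ = ψ_P`, `ψ′ = serreTranslateInv`).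

## References
* [MumfordAV1970] D. Mumford, *Abelian Varieties* (1970), §15 Thm. 1 (p. 143), §8 (iv) (p. 75).
* [MilneAV2008] J. S. Milne, *Abelian Varieties* (2008), I §9 Thm. 9.1 (p. 42).
* Tree: ★ `DualIsogenyMulN`, ★ `AbelianSchemeDualIsogenyComp`, ★ `AbelianSchemeQuotientPolarizationIdentity` (`dualIsogenyOver_congr`),
  ★ `SerreTensorIdealTranslationQuasiInverse`, ★ `AbelianSchemeHomDescentPolarized`.
-/

noncomputable section

universe u

open CategoryTheory CategoryTheory.Limits AlgebraicGeometry MonoidalCategory CartesianMonoidalCategory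
open scoped MonObj

namespace Literature.AlgebraicGeometry.AbelianSchemes

namespace AbelianSchemeOver

variable {S : Scheme.{u}} [IsReduced S] [IsLocallyNoetherian S]

/-- **`ψ′ ≫ ψ = [N]_C ⟹ ψ^∨ ≫ ψ′^∨ = [N]_{Ĉ}`** (dual of a quasi-inverse pair). [cite: MumfordAV1970, §15 Thm. 1 (p. 143)] [cite: MilneAV2008, I §9 Thm. 9.1 (p. 42)] -/
theorem dualIsogenyOver_comp_dualIsogenyOver_eq_pow_id {A C : AbelianSchemeOver S} (ψ : A.X ⟶ C.X) (ψ' : C.X ⟶ A.X) [IsMonHom ψ] [IsMonHom ψ']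
    (DA : A.DualPair) (DC : C.DualPair)
    (hDC : Nonempty ((Scheme.Modules.pullback (DualPair.unitHatSlice DC)).obj DC.P ≅ SheafOfModules.unit _)) {N : ℕ}
    (h : ψ' ≫ ψ = (𝟙 C.X) ^ N) :
    DualPair.dualIsogenyOver ψ DA DC ≫ DualPair.dualIsogenyOver ψ' DC DA = (𝟙 DC.hat.X) ^ N := by
  rw [← DualPair.dualIsogenyOver_comp ψ' ψ DC DA DC]
  exact (DualPair.dualIsogenyOver_congr DC DC (ψ₁ := ψ' ≫ ψ) (ψ₂ := C.mulN N) h).trans (DC.dualIsogenyOver_mulN hDC N)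

/-- **The dual of the ideal translation has a quasi-inverse**: `ψ_P^∨ ≫ ψ′^∨ = [N]` on the dual of `A ⊗_𝒪 𝔟` — the `hχ` of ★ polarised recognition for `ψ := ψ_P`.
[cite: MumfordAV1970, §15 Thm. 1 (p. 143)] [cite: Conrad2004GrossZagier, §7 (Thm. 7.5)] -/
theorem dualIsogenyOver_serreTranslate_comp_eq_pow_id {A : AbelianSchemeOver S} {O : Type*} [CommRing O] (act : A.RingAction O) [IsCommMonObj A.X]
    {m : ℕ} (E' : Matrix (Fin m) (Fin m) O) (hE' : E' * E' = E') (P : Matrix (Fin m) (Fin 1) O) (Q : Matrix (Fin 1) (Fin m) O) {N : ℕ}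
    (hP : E' * P = P) (hQ : Q * E' = Q) (hPQ : P * Q = Matrix.scalar (Fin m) (N : O) * E')
    [IsMonHom (serreTranslate act E' hE' P)] [IsMonHom (serreTranslateInv act E' hE' Q)]
    (DA : A.DualPair) (DC : (serreTensor act E' hE').DualPair)
    (hDC : Nonempty ((Scheme.Modules.pullback (DualPair.unitHatSlice DC)).obj DC.P ≅ SheafOfModules.unit _)) :
    DualPair.dualIsogenyOver (serreTranslate act E' hE' P) DA DC ≫ DualPair.dualIsogenyOver (serreTranslateInv act E' hE' Q) DC DA =
      (𝟙 DC.hat.X) ^ N :=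
  dualIsogenyOver_comp_dualIsogenyOver_eq_pow_id _ _ DA DC hDC (serreTranslateInv_comp_serreTranslate act E' hE' P Q hP hQ hPQ)

end AbelianSchemeOver

end Literature.AlgebraicGeometry.AbelianSchemes

end
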